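import Literature.AlgebraicGeometry.Resolution.ChowLemmaGeneralProofs
import Literature.AlgebraicGeometry.Resolution.ChowLemmaRing
import HarnessLib

/-!
# Chow's lemma over an affine Noetherian base, general (non-integral) form

The Stacks Project, Tag 0200 (Cohomology of Schemes, Lemma 30.18.1, "Chow's lemma", Noetherian
case): "Let `S` be a Noetherian scheme. Let `f : X → S` be a separated morphism of finite type. Then
there exists an `n ≥ 0` and a diagram `X ← X' → 𝐏ⁿ_S` where `X' → 𝐏ⁿ_S` is an immersion, and
`π : X' → X` is proper and surjective. Moreover, there exists an open dense subscheme `U ⊂ X` such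
that `π⁻¹(U) → U` is an isomorphism of schemes" — here for the AFFINE base `S = Spec R`.

The tree proves this statement over a FIELD (`ChowLemmaProof.exists_chow`, discharging the named
fact `ChowLemma`) and, over a ring `R`, only the INTEGRAL form (`ChowLemmaRing.chow`,
Görtz–Wedhorn I Thm. 13.100 (2)). The chart machinery of `ChowLemmaGeneralProofs`
(`ChowLemmaProof.exists_affine_cover_dense_iInf`, `isImmersion_snd`, `surjective`,
`isIsoMorphismRestrict`) is written for an arbitrary base; the three base-specific inputs —
quasi-projectivity of affine `R`-schemes of finite type (`ChowLemmaRing.exists_immersion_projOver`),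
projective weak products (`ChowLemmaRing.exists_weakProd`) and properness of `ℙⁿ_R` — are in
`ChowLemmaRing`. This file re-runs the printed proof of Tag 0200 with those inputs:

* `ChowLemmaRing.chow_of_finite_irreducibleComponents` — Chow's lemma over `Spec R` for `f : X → Spec R`
  separated, of finite type, `X` quasi-compact with finitely many irreducible components (the
  hypothesis under which Tag 0200 / GW Thm. 13.100 are printed; automatic for `R` Noetherian);
* `ChowLemmaRing.chow_noetherian` — the same for `R` Noetherian;
* `ChowLemmaRing.chow_proper_noetherian` — **for `f` proper, `X' → ℙⁿ_R` is a CLOSED immersion**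
  (GW I Thm. 13.100 (1): `X'` is proper over `R` and `ℙⁿ_R → Spec R` is separated), the form used by
  the proof of Grothendieck's existence theorem in the proper case (The Stacks Project, Tag 088C).

Everything is proved; no named facts are introduced.

## References

* The Stacks Project, Tag 0200 (Cohomology of Schemes, Lemma 30.18.1) in Section Tag 02O2, and
  Remark Tag 0201. [StacksProject]
* U. Görtz, T. Wedhorn, *Algebraic Geometry I: Schemes*, 2nd ed. (2020), Thm. 13.100 (PDF p. 529).
  [GortzWedhorn2020]
* A. Grothendieck, EGA II, Thm. 5.6.1. [EGAII]
-/

universe u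

open CategoryTheory Limits TopologicalSpace AlgebraicGeometry

noncomputable section

namespace Literature.AlgebraicGeometry.Resolution

namespace ChowLemmaRing

open ChowLemmaProof

variable (R : Type u) [CommRing R]

/-- **Chow's lemma over `Spec R`** (The Stacks Project, Tag 0200, base `S = Spec R`): for
`f : X → Spec R` separated and of finite type, with `X` having finitely many irreducible components,
there are `n`, a scheme `X'`, a proper surjective `π : X' → X`, an immersion `ι : X' → ℙⁿ_R` over `R`
(`ι ≫ (ℙⁿ_R → Spec R) = π ≫ f`) and a dense open `U ⊆ X` with `π⁻¹(U) → U` an isomorphism. Proof as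
printed (and as in the tree's `ChowLemmaProof.exists_chow` over a field): a finite affine open cover
`X = ⋃ Uᵢ` with dense intersection `U₀` containing all generic points, immersions `Uᵢ ↪ ℙ^{nᵢ}_R`,
the scheme-theoretic image `X'` of the graph `U₀ → X ×_R ∏ ℙ^{nᵢ}_R`.
[cite: StacksProject, Tag 0200 (Lemma 30.18.1)] -/
theorem chow_of_finite_irreducibleComponents (X : Scheme.{u}) (f : X ⟶ Spec (.of R))
    [IsSeparated f] [LocallyOfFiniteType f] [CompactSpace X]
    (hfin : (irreducibleComponents X).Finite) :
    ∃ (n : ℕ) (X' : Scheme.{u}) (π : X' ⟶ X) (ι : X' ⟶ (projOver R n).left),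
      IsImmersion ι ∧ IsProper π ∧ Surjective π ∧ ι ≫ (projOver R n).hom = π ≫ f ∧
        ∃ U : X.Opens, Dense (U : Set X) ∧ IsIso (π ∣_ U) := by
  classical
  -- Step 1: a finite affine open cover with dense intersection `U₀`
  obtain ⟨m, U, hUaff, hUcov, -, hUdense⟩ := exists_affine_cover_dense_iInf X hfin
  -- Step 2: immersions of the charts into projective spaces over `R`
  have hj : ∀ i, ∃ (n : ℕ) (j : (U i : Scheme.{u}) ⟶ (projOver R n).left),
      IsImmersion j ∧ j ≫ (projOver R n).hom = (U i).ι ≫ f := fun i ↦ by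
    haveI : IsAffine (U i) := hUaff i
    exact exists_immersion_projOver ((U i).ι ≫ f)
  choose n j hj hjf using hj
  -- Step 3: a projective weak product `P` of the target projective spaces
  obtain ⟨P, pr, hP, hlift⟩ := exists_weakProd m (fun i ↦ projOver R (n i))
    fun i ↦ ⟨n i, 𝟙 _, inferInstance⟩
  haveI : IsProper P.hom := hP.isProper
  obtain ⟨N, emb, hemb⟩ := hP
  -- Step 4: the graph `e : U₀ → X ×_R P` of `(j₀, …, jₘ)|_{U₀}`
  let U₀ : X.Opens := ⨅ i, U i
  have ht : ∀ i, (X.homOfLE (iInf_le U i) ≫ j i) ≫ (projOver R (n i)).hom = U₀.ι ≫ f :=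
    fun i ↦ by rw [Category.assoc, hjf, Scheme.homOfLE_ι_assoc]
  let t : ∀ i, (Over.mk (U₀.ι ≫ f) : Motives.SchemeOver R) ⟶ projOver R (n i) := fun i ↦
    Over.homMk (X.homOfLE (iInf_le U i) ≫ j i) (ht i)
  obtain ⟨jt, hjt⟩ := hlift _ t
  have hw : U₀.ι ≫ f = jt.left ≫ P.hom := (Over.w jt).symm
  let e : (U₀ : Scheme.{u}) ⟶ pullback f P.hom := pullback.lift U₀.ι jt.left hw
  -- `U₀` is quasi-compact (a finite intersection of affine opens in a quasi-separated scheme)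
  haveI : X.IsSeparated := (HasAffineProperty.iff_of_isAffine (P := @IsSeparated)).mp ‹_›
  have hU₀cpt : IsCompact ((U₀ : X.Opens) : Set X) := by
    have key : ∀ s : Finset (Fin (m + 1)), IsCompact ((s.inf U : X.Opens) : Set X) := by
      intro s
      induction s using Finset.induction_on with
      | empty => simpa using isCompact_univ
      | insert i s hi ih =>
        rw [Finset.inf_insert]
        change IsCompact ((U i : Set X) ∩ (s.inf U : X.Opens))
        exact (hUaff i).isCompact.inter_of_isOpen ih (U i).isOpen (s.inf U).isOpen
    have hU₀ : U₀ = Finset.univ.inf U := by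
      apply le_antisymm
      · exact Finset.le_inf fun i _ ↦ iInf_le U i
      · exact le_iInf fun i ↦ Finset.inf_le (Finset.mem_univ i)
    rw [hU₀]
    exact key _
  haveI : CompactSpace (U₀ : Scheme.{u}) := isCompact_iff_compactSpace.mp hU₀cpt
  haveI : QuasiCompact e := by
    have : QuasiCompact (e ≫ pullback.fst f P.hom) := by rw [pullback.lift_fst]; infer_instance
    exact QuasiCompact.of_comp e (pullback.fst f P.hom)
  have he₁ : e ≫ pullback.fst f P.hom = U₀.ι := pullback.lift_fst _ _ _
  have he₂ : ∀ i, e ≫ pullback.snd f P.hom ≫ (pr i).left =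
      X.homOfLE (iInf_le U i) ≫ (j i).liftCoborder ≫ (j i).coborderRange.ι := fun i ↦ by
    have h : (jt.left ≫ (pr i).left : (U₀ : Scheme.{u}) ⟶ (projOver R (n i)).left) =
        X.homOfLE (iInf_le U i) ≫ j i := congr($(hjt i).left)
    calc e ≫ pullback.snd f P.hom ≫ (pr i).left
        = (jt.left ≫ (pr i).left : (U₀ : Scheme.{u}) ⟶ (projOver R (n i)).left) := by
          rw [pullback.lift_snd_assoc]
      _ = X.homOfLE (iInf_le U i) ≫ j i := h
      _ = _ := by rw [Scheme.Hom.liftCoborder_ι]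
  haveI : ∀ i, IsSeparated (projOver R (n i)).hom := fun i ↦ IsProper.toIsSeparated
  haveI : IsImmersion (e.imageι ≫ pullback.snd f P.hom) :=
    isImmersion_snd f P.hom (fun i ↦ (projOver R (n i)).left)
      (fun i ↦ (projOver R (n i)).hom) (fun i ↦ (pr i).left) (fun i ↦ Over.w (pr i)) U U₀
      (fun i ↦ iInf_le U i) (fun i ↦ (j i).coborderRange) (fun i ↦ (j i).liftCoborder)
      (fun i ↦ by rw [Scheme.Hom.liftCoborder_ι_assoc, hjf]) e he₁ he₂ hUcov
  refine ⟨N, e.image, e.imageι ≫ pullback.fst f P.hom,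
    (e.imageι ≫ pullback.snd f P.hom) ≫ emb.left, inferInstance, inferInstance, ?_, ?_, U₀, hUdense, ?_⟩
  · exact surjective f P.hom U₀ e he₁ hUdense
  · rw [Category.assoc, Over.w emb, Category.assoc, Category.assoc, pullback.condition]
  · exact isIso_morphismRestrict f P.hom U₀ e he₁

/-- **Chow's lemma over a Noetherian ring** (The Stacks Project, Tag 0200 with `S = Spec R`, `R`
Noetherian): for `f : X → Spec R` separated of finite type there are `n`, `X'`, a proper surjective
`π : X' → X`, an immersion `X' → ℙⁿ_R` over `R` and a dense open `U ⊆ X` over which `π` is an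
isomorphism. [cite: StacksProject, Tag 0200 (Lemma 30.18.1)] -/
theorem chow_noetherian [IsNoetherianRing R] (X : Scheme.{u}) (f : X ⟶ Spec (.of R))
    [IsSeparated f] [LocallyOfFiniteType f] [QuasiCompact f] :
    ∃ (n : ℕ) (X' : Scheme.{u}) (π : X' ⟶ X) (ι : X' ⟶ (projOver R n).left),
      IsImmersion ι ∧ IsProper π ∧ Surjective π ∧ ι ≫ (projOver R n).hom = π ≫ f ∧
        ∃ U : X.Opens, Dense (U : Set X) ∧ IsIso (π ∣_ U) := by
  haveI : IsLocallyNoetherian X := LocallyOfFiniteType.isLocallyNoetherian f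
  haveI : CompactSpace X := QuasiCompact.compactSpace_of_compactSpace f
  haveI : IsNoetherian X := ⟨⟩
  exact chow_of_finite_irreducibleComponents R X f finite_irreducibleComponents_of_isNoetherian

/-- **Chow's lemma over a Noetherian ring for proper `X`, with a closed immersion** (GW I
Thm. 13.100 (1); the form used in The Stacks Project, Tag 088C): if `f : X → Spec R` is proper, `R`
Noetherian, there are `n`, `X'`, a proper surjective `π : X' → X`, a CLOSED immersion `ι : X' → ℙⁿ_R`
over `R` and a dense open `U ⊆ X` with `π⁻¹(U) → U` an isomorphism.
[cite: GortzWedhorn2020, Thm 13.100] [cite: StacksProject, Tag 0200] -/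
theorem chow_proper_noetherian [IsNoetherianRing R] (X : Scheme.{u}) (f : X ⟶ Spec (.of R))
    [IsProper f] :
    ∃ (n : ℕ) (X' : Scheme.{u}) (π : X' ⟶ X) (ι : X' ⟶ (projOver R n).left),
      IsClosedImmersion ι ∧ IsProper π ∧ Surjective π ∧ ι ≫ (projOver R n).hom = π ≫ f ∧
        ∃ U : X.Opens, Dense (U : Set X) ∧ IsIso (π ∣_ U) := by
  obtain ⟨n, X', π, ι, h1, h2, h3, h4, hU⟩ := chow_noetherian R X f
  refine ⟨n, X', π, ι, ?_, h2, h3, h4, hU⟩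
  haveI : IsProper (ι ≫ (projOver R n).hom) := by rw [h4]; infer_instance
  haveI : IsProper ι := IsProper.of_comp ι (projOver R n).hom
  exact IsClosedImmersion.of_isPreimmersion ι ι.isClosedMap.isClosed_range

end ChowLemmaRing

end Literature.AlgebraicGeometry.Resolution

end
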